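import Summits.Ventures.PercRepro2.CaseOnePendantTreeAnchors
import Summits.Ventures.PercRepro2.CaseOneDegenerate

/-!
# Pendant trees at a mark, and the closed anchors as one predicate
(blind cell PercRepro2, p1 g22; S5 §2.1: `fourForms_of_pendantTree` at the marks themselves and at the
union of the closed anchors)

The coincident markings have all four forms for every finite graph and every weight vector
(`CaseOneDegenerate`: `zSplitII/IIQ/I/IQ_of_{o,a1,a2,b}_eq_a3`), so a MARK is an anchor with no condition
at all on its edges (`MarkAnchor`): **every vertex of every pendant tree hanging at `o`, `a₁`, `a₂` or `b`
has the four forms** (`fourForms_of_pendantTree_mark`), with `(J1)` and `(RV)` — in particular the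
pendant-at-a-mark class of `CaseOnePendantMark` gets its two Q-forms, and the pendant paths and trees at
a mark of any shape every row. `ClosedAnchor` is the union of the five closed anchors (mark, marked star,
uwob gadget, roots-only, roots-and-`o`): `fourForms_of_pendantTree_closedAnchor` is the one statement
«every row of the class table at every vertex of every pendant tree hanging at a closed vertex».
Finally the closure statement itself: `FourFormsAll R o a₁ a₂ b E ends v` says that `v` has the four
forms in `(E, ends)` for EVERY weight vector, and `fourForms_of_pendantTree_fourFormsAll` says that this
property of a vertex is inherited by every vertex of every pendant tree grown at it — the closed set of
the rung is closed under attaching pendant trees. Own code; standard axioms. -/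

namespace Summit.Ventures.PercRepro2

namespace CaseOne

universe u

section MarkAnchorDef
variable {V : Type*}

/-- The mark anchor: the anchor is one of the four marks; no condition on its edges. -/
def MarkAnchor (o a₁ a₂ b : V) (E : Type u) (_ends : E → Sym2 V) (v : V) : Prop :=
  v = o ∨ v = a₁ ∨ v = a₂ ∨ v = b

/-- The union of the five closed anchors: a mark, a marked star, a uwob gadget, a roots-only vertex, a
roots-and-`o` vertex. -/
def ClosedAnchor (o a₁ a₂ b : V) (E : Type u) (ends : E → Sym2 V) (v : V) : Prop :=
  MarkAnchor o a₁ a₂ b E ends v ∨ MarkedStarAnchor o a₁ a₂ b E ends v ∨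
    GadgetUWOBAnchor o a₁ a₂ b E ends v ∨ RootsOnlyAnchor o a₁ a₂ b E ends v ∨
      RootsAndOAnchor o a₁ a₂ b E ends v

variable (o a₁ a₂ b : V)

/-- The mark anchor is symmetric in the roots. -/
theorem MarkAnchor.swap (E : Type u) (ends : E → Sym2 V) (v : V) (h : MarkAnchor o a₁ a₂ b E ends v) :
    MarkAnchor o a₂ a₁ b E ends v := by
  rcases h with h | h | h | h
  · exact Or.inl h
  · exact Or.inr (Or.inr (Or.inl h))
  · exact Or.inr (Or.inl h)
  · exact Or.inr (Or.inr (Or.inr h))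

/-- The union of the closed anchors is symmetric in the roots. -/
theorem ClosedAnchor.swap (E : Type u) (ends : E → Sym2 V) (v : V)
    (h : ClosedAnchor o a₁ a₂ b E ends v) : ClosedAnchor o a₂ a₁ b E ends v := by
  rcases h with h | h | h | h | h
  · exact Or.inl (MarkAnchor.swap o a₁ a₂ b E ends v h)
  · exact Or.inr (Or.inl (MarkedStarAnchor.swap o a₁ a₂ b E ends v h))
  · exact Or.inr (Or.inr (Or.inl (GadgetUWOBAnchor.swap o a₁ a₂ b E ends v h)))
  · exact Or.inr (Or.inr (Or.inr (Or.inl (RootsOnlyAnchor.swap o a₁ a₂ b E ends v h))))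
  · exact Or.inr (Or.inr (Or.inr (Or.inr (RootsAndOAnchor.swap o a₁ a₂ b E ends v h))))

end MarkAnchorDef

section Marks
variable {V : Type*} [Fintype V] [DecidableEq V] {R : Type*} [Field R] [LinearOrder R]
  [IsStrictOrderedRing R]
variable (o a₁ a₂ b : V)

/-- A mark has the four forms (`CaseOneDegenerate`). -/
theorem fourForms_of_markAnchor (E : Type u) [Fintype E] [DecidableEq E] (ends : E → Sym2 V)
    (p : E → R) (hp : IsProbVec p) (v : V) (h : MarkAnchor o a₁ a₂ b E ends v) :
    FourForms p ends o a₁ a₂ v b := by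
  rcases h with rfl | rfl | rfl | rfl
  · exact ⟨zSplitII_of_o_eq_a3 p hp a₁ a₂ _ b, zSplitIIQ_of_o_eq_a3 p hp a₁ a₂ _ b,
      zSplitI_of_o_eq_a3 p hp a₁ a₂ _ b, zSplitIQ_of_o_eq_a3 p hp a₁ a₂ _ b⟩
  · exact ⟨zSplitII_of_a1_eq_a3 p hp o _ a₂ b, zSplitIIQ_of_a1_eq_a3 p hp o _ a₂ b,
      zSplitI_of_a1_eq_a3 p hp o _ a₂ b, zSplitIQ_of_a1_eq_a3 p hp o _ a₂ b⟩
  · exact ⟨zSplitII_of_a2_eq_a3 p o a₁ _ b, zSplitIIQ_of_a2_eq_a3 p o a₁ _ b,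
      zSplitI_of_a2_eq_a3 p o a₁ _ b, zSplitIQ_of_a2_eq_a3 p o a₁ _ b⟩
  · exact ⟨zSplitII_of_b_eq_a3 p hp o a₁ a₂ _, zSplitIIQ_of_b_eq_a3 p hp o a₁ a₂ _,
      zSplitI_of_b_eq_a3 p hp o a₁ a₂ _, zSplitIQ_of_b_eq_a3 p hp o a₁ a₂ _⟩

/-- A closed anchor has the four forms. -/
theorem fourForms_of_closedAnchor (E : Type u) [Fintype E] [DecidableEq E] (ends : E → Sym2 V)
    (p : E → R) (hp : IsProbVec p) (v : V) (h : ClosedAnchor o a₁ a₂ b E ends v) :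
    FourForms p ends o a₁ a₂ v b := by
  rcases h with h | h | h | h | h
  · exact fourForms_of_markAnchor o a₁ a₂ b E ends p hp v h
  · exact fourForms_of_markedStarAnchor o a₁ a₂ b E ends p hp v h
  · exact fourForms_of_gadgetUWOBAnchor o a₁ a₂ b E ends p hp v h
  · exact fourForms_of_rootsOnlyAnchor o a₁ a₂ b E ends p hp v h
  · exact fourForms_of_rootsAndOAnchor o a₁ a₂ b E ends p hp v h

variable {E : Type u} [Fintype E] [DecidableEq E] {ends : E → Sym2 V} {v y : V} {S : Set V} {n : ℕ}

/-- **The four forms at every vertex of a pendant tree hanging at a mark**, every finite graph, every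
weight vector. -/
theorem fourForms_of_pendantTree_mark (p : E → R) (hp : IsProbVec p)
    (h : IsPendantTreeAt (MarkAnchor o a₁ a₂ b) o a₁ a₂ b n E ends v S) (hy : y ∈ S) :
    FourForms p ends o a₁ a₂ y b :=
  fourForms_of_pendantTree (MarkAnchor o a₁ a₂ b) o a₁ a₂ b (fourForms_of_markAnchor o a₁ a₂ b)
    n E ends p hp v S h y hy

/-- **`(J1)` at every vertex of a pendant tree hanging at a mark.** -/
theorem jOne_of_pendantTree_mark (p : E → R) (hp : IsProbVec p)
    (h : IsPendantTreeAt (MarkAnchor o a₁ a₂ b) o a₁ a₂ b n E ends v S) (hy : y ∈ S) :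
    JOne p ends o a₁ a₂ y b :=
  jOne_of_pendantTree (MarkAnchor o a₁ a₂ b) (fourForms_of_markAnchor o a₁ a₂ b)
    (fun E' _ _ ends' p' hp' v' h' =>
      fourForms_of_markAnchor o a₂ a₁ b E' ends' p' hp' v' (MarkAnchor.swap o a₁ a₂ b E' ends' v' h'))
    p hp h hy

/-- **`(RV)` at every vertex of a pendant tree hanging at a mark.** -/
theorem rv_of_pendantTree_mark (p : E → R) (hp : IsProbVec p)
    (h : IsPendantTreeAt (MarkAnchor o a₁ a₂ b) o a₁ a₂ b n E ends v S) (hy : y ∈ S)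
    (hT : 0 < prob p (Tp ends a₁ a₂ y)) : RV p ends o a₁ a₂ y b :=
  rv_of_pendantTree (MarkAnchor o a₁ a₂ b) (fourForms_of_markAnchor o a₁ a₂ b) p hp h hy hT

/-- **The four forms at every vertex of every pendant tree hanging at a closed vertex** (a mark, a
marked star, a uwob gadget, a roots-only or a roots-and-`o` vertex), every finite graph, every weight
vector. -/
theorem fourForms_of_pendantTree_closedAnchor (p : E → R) (hp : IsProbVec p)
    (h : IsPendantTreeAt (ClosedAnchor o a₁ a₂ b) o a₁ a₂ b n E ends v S) (hy : y ∈ S) :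
    FourForms p ends o a₁ a₂ y b :=
  fourForms_of_pendantTree (ClosedAnchor o a₁ a₂ b) o a₁ a₂ b (fourForms_of_closedAnchor o a₁ a₂ b)
    n E ends p hp v S h y hy

/-- **`(J1)` at every vertex of every pendant tree hanging at a closed vertex.** -/
theorem jOne_of_pendantTree_closedAnchor (p : E → R) (hp : IsProbVec p)
    (h : IsPendantTreeAt (ClosedAnchor o a₁ a₂ b) o a₁ a₂ b n E ends v S) (hy : y ∈ S) :
    JOne p ends o a₁ a₂ y b :=
  jOne_of_pendantTree (ClosedAnchor o a₁ a₂ b) (fourForms_of_closedAnchor o a₁ a₂ b)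
    (fun E' _ _ ends' p' hp' v' h' =>
      fourForms_of_closedAnchor o a₂ a₁ b E' ends' p' hp' v' (ClosedAnchor.swap o a₁ a₂ b E' ends' v' h'))
    p hp h hy

/-- **`(RV)` at every vertex of every pendant tree hanging at a closed vertex.** -/
theorem rv_of_pendantTree_closedAnchor (p : E → R) (hp : IsProbVec p)
    (h : IsPendantTreeAt (ClosedAnchor o a₁ a₂ b) o a₁ a₂ b n E ends v S) (hy : y ∈ S)
    (hT : 0 < prob p (Tp ends a₁ a₂ y)) : RV p ends o a₁ a₂ y b :=
  rv_of_pendantTree (ClosedAnchor o a₁ a₂ b) (fourForms_of_closedAnchor o a₁ a₂ b) p hp h hy hT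

end Marks

section Closure
variable {V : Type*}

/-- `v` has the four forms in `(E, ends)` for EVERY weight vector over `R`: the property that the
pendant-tree construction preserves. -/
def FourFormsAll (R : Type*) [CommRing R] [LinearOrder R] (o a₁ a₂ b : V) (E : Type u)
    (ends : E → Sym2 V) (v : V) : Prop :=
  ∀ [Fintype E] [DecidableEq E] (p : E → R), IsProbVec p → FourForms p ends o a₁ a₂ v b

variable {R : Type*} [CommRing R] [LinearOrder R] [IsStrictOrderedRing R]
variable (o a₁ a₂ b : V) {E : Type u} [Fintype E] [DecidableEq E] {ends : E → Sym2 V} {v y : V}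
  {S : Set V} {n : ℕ}

/-- **The closure statement**: if the anchor has the four forms for every weight vector in the graph
with the tree deleted, then every vertex of the pendant tree has them in `G`, for every weight vector —
the closed set of the rung is closed under attaching pendant trees of any shape. -/
theorem fourForms_of_pendantTree_fourFormsAll (p : E → R) (hp : IsProbVec p)
    (h : IsPendantTreeAt (FourFormsAll R o a₁ a₂ b) o a₁ a₂ b n E ends v S) (hy : y ∈ S) :
    FourForms p ends o a₁ a₂ y b :=
  fourForms_of_pendantTree (FourFormsAll R o a₁ a₂ b) o a₁ a₂ b
    (fun _ _ _ _ p' hp' _ h' => h' p' hp') n E ends p hp v S h y hy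

/-- Every vertex of a pendant tree at a closed anchor has the four forms for every weight vector: the
tree vertices are themselves closed anchors in the sense of `FourFormsAll`. -/
theorem fourFormsAll_of_pendantTree_fourFormsAll
    (h : IsPendantTreeAt (FourFormsAll R o a₁ a₂ b) o a₁ a₂ b n E ends v S) (hy : y ∈ S) :
    FourFormsAll R o a₁ a₂ b E ends y := by
  intro inst₁ inst₂ p hp
  -- the quantified instances are the ambient ones (subsingletons): restate `h` under them
  have h' : IsPendantTreeAt (FourFormsAll R o a₁ a₂ b) o a₁ a₂ b n E ends v S := by
    convert h using 2
  exact fourForms_of_pendantTree_fourFormsAll o a₁ a₂ b p hp h' hy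

end Closure

end CaseOne

end Summit.Ventures.PercRepro2
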